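import Literature.MathematicalPhysics.QuantumLattice.DysonOrderedIntegral
import Mathlib.MeasureTheory.Measure.Lebesgue.EqHaar
import Mathlib.MeasureTheory.Constructions.Pi
import HarnessLib

/-!
# Ordered (simplex) integrals as set integrals, and symmetrisation: `∫_{0≤u₀≤⋯≤u_{k-1}≤t} Φ = (k!)⁻¹ ∫_{[0,t]^k} Φ`

Topic `MathematicalPhysics/QuantumLattice`; complement to `DysonOrderedIntegral.lean` (the iterated simplex
integral `orderedIntegral k Φ t` of the Dyson series, Bratteli–Robinson I Thm. 3.1.33) and
`OrderedIntegralSymmetric.lean` (the product case `I_k(∏ f) = (∫f)^k/k!`). PROVED here, for every continuous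
integrand `Φ : (Fin k → ℝ) → E` and `t ≥ 0`:

* `orderedIntegral_eq_setIntegral_simplex` — the iterated integral IS the Lebesgue integral over the
  ordered simplex `Δ_k(t) = {u : 0 ≤ u₀ ≤ ⋯ ≤ u_{k-1} ≤ t}` (Fubini through
  `MeasurableEquiv.piFinSuccAbove … (Fin.last k)`, whose inverse is `Fin.snoc`);
* **`orderedIntegral_eq_inv_factorial_smul_setIntegral_cube`** — if `Φ` is SYMMETRIC under permutations
  of the variables then `I_k Φ t = (k!)⁻¹ ∫_{[0,t]^k} Φ`: the cube is, up to the null set where two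
  coordinates coincide (a finite union of proper linear subspaces, `Measure.addHaar_submodule`), the disjoint
  union over `σ ∈ 𝔖_k` of the open simplices `{u ∈ [0,t]^k : u ∘ σ strictly increasing}`, each of which has
  the same integral as `Δ_k(t)` (the coordinate permutation is measure preserving,
  `volume_measurePreserving_piCongrLeft`, and `Φ` is symmetric).

This is the passage between TIME-ORDERED (Dyson, operator formalism) and UNORDERED (functional-integral)
imaginary-time integrals — Benfatto–Giuliani–Mastropietro 2006 (2.6)–(2.8) "pass freely between the two" —
for arbitrary symmetric integrands (sums over words and trees of propagator products are symmetric under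
relabelling of the vertices), the `1/k!` being what makes tree-graph bounds with `k^{k-2}` trees summable.
Everything is PROVED; no definition (the simplex and the cube are written as `setOf` / `Set.pi`).

## References
* O. Bratteli, D. W. Robinson, *Operator Algebras and Quantum Statistical Mechanics I*, 2nd ed. (1987),
  Thm. 3.1.33 and the remark following it. [cite: BratteliRobinsonI1987, Thm. 3.1.33]
* G. Benfatto, A. Giuliani, V. Mastropietro, Ann. Henri Poincaré 7 (2006) 809–898, §2.1 (2.6)–(2.8).
  [cite: BenfattoGiulianiMastropietro2006, (2.6)–(2.8)]
-/

noncomputable section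

open MeasureTheory Set Filter Topology
open scoped Nat

namespace Literature.MathematicalPhysics.QuantumLattice

variable {E : Type*} [NormedAddCommGroup E] [NormedSpace ℝ E] [CompleteSpace E]

/-! ### The ordered simplex `Δ_k(t)` -/

section Simplex

/-- The ordered simplex is closed. [folklore] -/
theorem isClosed_simplex (k : ℕ) (t : ℝ) :
    IsClosed {w : Fin k → ℝ | (∀ i, w i ∈ Icc (0 : ℝ) t) ∧ Monotone w} := by
  have h1 : IsClosed {w : Fin k → ℝ | ∀ i, w i ∈ Icc (0 : ℝ) t} := by
    rw [setOf_forall]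
    refine isClosed_iInter fun i => ?_
    exact isClosed_Icc.preimage (continuous_apply i)
  have h2 : IsClosed {w : Fin k → ℝ | Monotone w} := by
    have : {w : Fin k → ℝ | Monotone w} = ⋂ i : Fin k, ⋂ j : Fin k, {w | i ≤ j → w i ≤ w j} := by
      ext w; simp only [mem_setOf_eq, mem_iInter, Monotone]
    rw [this]
    refine isClosed_iInter fun i => isClosed_iInter fun j => ?_
    by_cases hij : i ≤ j
    · simp only [hij, true_implies]
      exact isClosed_le (continuous_apply i) (continuous_apply j)
    · simp only [hij, false_implies, setOf_true]
      exact isClosed_univ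
  simpa only [setOf_and] using h1.inter h2

/-- The ordered simplex is measurable. [folklore] -/
theorem measurableSet_simplex (k : ℕ) (t : ℝ) :
    MeasurableSet {w : Fin k → ℝ | (∀ i, w i ∈ Icc (0 : ℝ) t) ∧ Monotone w} :=
  (isClosed_simplex k t).measurableSet

/-- The ordered simplex lies in the cube. [folklore] -/
theorem simplex_subset_cube (k : ℕ) (t : ℝ) :
    {w : Fin k → ℝ | (∀ i, w i ∈ Icc (0 : ℝ) t) ∧ Monotone w} ⊆ Set.pi univ fun _ => Icc (0 : ℝ) t :=
  fun _ hw => mem_univ_pi.mpr hw.1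

/-- The cube `[0,t]^k` is compact. [folklore] -/
theorem isCompact_cube (k : ℕ) (t : ℝ) : IsCompact (Set.pi univ fun _ : Fin k => Icc (0 : ℝ) t) :=
  isCompact_univ_pi fun _ => isCompact_Icc

/-- The ordered simplex is compact. [folklore] -/
theorem isCompact_simplex (k : ℕ) (t : ℝ) :
    IsCompact {w : Fin k → ℝ | (∀ i, w i ∈ Icc (0 : ℝ) t) ∧ Monotone w} :=
  (isCompact_cube k t).of_isClosed_subset (isClosed_simplex k t) (simplex_subset_cube k t)

/-- **Slicing the simplex by the last variable**: `Fin.snoc w u ∈ Δ_{k+1}(t)` iff `u ∈ [0,t]` and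
`w ∈ Δ_k(u)`. [folklore] -/
theorem snoc_mem_simplex_iff (k : ℕ) (t : ℝ) (w : Fin k → ℝ) (u : ℝ) :
    (Fin.snoc w u : Fin (k + 1) → ℝ) ∈ {v : Fin (k + 1) → ℝ | (∀ i, v i ∈ Icc (0 : ℝ) t) ∧ Monotone v} ↔
      u ∈ Icc (0 : ℝ) t ∧ w ∈ {v : Fin k → ℝ | (∀ i, v i ∈ Icc (0 : ℝ) u) ∧ Monotone v} := by
  simp only [mem_setOf_eq]
  constructor
  · rintro ⟨hb, hm⟩
    have hu : u ∈ Icc (0 : ℝ) t := by simpa only [Fin.snoc_last] using hb (Fin.last k)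
    refine ⟨hu, fun i => ⟨?_, ?_⟩, fun i j hij => ?_⟩
    · simpa only [Fin.snoc_castSucc] using (hb (Fin.castSucc i)).1
    · have := hm (Fin.castSucc_lt_last i).le
      simpa only [Fin.snoc_castSucc, Fin.snoc_last] using this
    · have := hm (Fin.castSucc_le_castSucc_iff.mpr hij)
      simpa only [Fin.snoc_castSucc] using this
  · rintro ⟨hu, hb, hm⟩
    refine ⟨fun i => ?_, ?_⟩
    · refine Fin.lastCases ?_ (fun j => ?_) i
      · simpa only [Fin.snoc_last] using hu
      · simp only [Fin.snoc_castSucc]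
        exact ⟨(hb j).1, (hb j).2.trans hu.2⟩
    · refine Fin.monotone_iff_le_succ.mpr fun i => ?_
      rw [Fin.snoc_castSucc]
      by_cases hi : i.succ = Fin.last k
      · rw [hi, Fin.snoc_last]
        exact (hb i).2
      · obtain ⟨j, hj⟩ := Fin.exists_castSucc_eq.mpr hi
        rw [← hj, Fin.snoc_castSucc]
        refine hm ?_
        have : (Fin.castSucc i : Fin (k + 1)) ≤ Fin.castSucc j := by
          rw [hj]; exact Fin.castSucc_lt_succ.le
        exact Fin.castSucc_le_castSucc_iff.mp this

end Simplex

/-! ### The ordered integral is the integral over the simplex -/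

section SetIntegral

/-- **The iterated ordered integral is the Lebesgue integral over the ordered simplex**: for continuous
`Φ` and `t ≥ 0`, `orderedIntegral k Φ t = ∫_{Δ_k(t)} Φ`. [cite: BratteliRobinsonI1987, Thm. 3.1.33] -/
theorem orderedIntegral_eq_setIntegral_simplex :
    ∀ (k : ℕ) (Φ : (Fin k → ℝ) → E), Continuous Φ → ∀ t : ℝ, 0 ≤ t →
      orderedIntegral k Φ t = ∫ w in {w : Fin k → ℝ | (∀ i, w i ∈ Icc (0 : ℝ) t) ∧ Monotone w}, Φ w
  | 0, Φ, _, t, _ => by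
    have hS : {w : Fin 0 → ℝ | (∀ i, w i ∈ Icc (0 : ℝ) t) ∧ Monotone w} = univ := by
      ext w
      simp only [mem_setOf_eq, mem_univ, iff_true]
      exact ⟨fun i => i.elim0, fun i => i.elim0⟩
    rw [orderedIntegral_zero, hS, Measure.restrict_univ, integral_unique, measureReal_def,
      volume_pi, Measure.pi_of_empty (fun _ : Fin 0 => (volume : Measure ℝ)) (fun i => i.elim0)]
    simp only [measure_univ, ENNReal.toReal_one, one_smul]
    exact congrArg Φ (Subsingleton.elim _ _)
  | k + 1, Φ, hΦ, t, ht => by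
    -- the induction hypothesis under the integral sign
    have IH : ∀ u : ℝ, 0 ≤ u → orderedIntegral k (fun w => Φ (Fin.snoc w u)) u =
        ∫ w in {w : Fin k → ℝ | (∀ i, w i ∈ Icc (0 : ℝ) u) ∧ Monotone w}, Φ (Fin.snoc w u) := fun u hu =>
      orderedIntegral_eq_setIntegral_simplex k _ (hΦ.comp ((continuous_finSnoc k).comp
        (continuous_id.prodMk continuous_const))) u hu
    rw [orderedIntegral_succ, intervalIntegral.integral_of_le ht,
      setIntegral_congr_fun measurableSet_Ioc (fun u hu => IH u hu.1.le), ← integral_Icc_eq_integral_Ioc]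
    -- the right-hand side through `ℝ × ℝ^k ≃ ℝ^{k+1}`, `(u, w) ↦ Fin.snoc w u`
    set S : Set (Fin (k + 1) → ℝ) := {v | (∀ i, v i ∈ Icc (0 : ℝ) t) ∧ Monotone v} with hS
    set e := MeasurableEquiv.piFinSuccAbove (fun _ : Fin (k + 1) => ℝ) (Fin.last k) with he
    have hsymm : ∀ p : ℝ × (Fin k → ℝ), e.symm p = Fin.snoc p.2 p.1 := by
      intro p
      rw [he, MeasurableEquiv.piFinSuccAbove_symm_apply]
      exact Fin.insertNth_last' p.1 p.2
    have hmp : MeasurePreserving e.symm (volume : Measure (ℝ × (Fin k → ℝ))) volume :=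
      (volume_preserving_piFinSuccAbove (fun _ : Fin (k + 1) => ℝ) (Fin.last k)).symm e
    have hpre : e.symm ⁻¹' S = {p : ℝ × (Fin k → ℝ) | p.1 ∈ Icc (0 : ℝ) t ∧
        p.2 ∈ {w : Fin k → ℝ | (∀ i, w i ∈ Icc (0 : ℝ) p.1) ∧ Monotone w}} := by
      ext p
      rw [mem_preimage, hsymm p, hS, snoc_mem_simplex_iff]
      rfl
    have key := hmp.setIntegral_preimage_emb e.symm.measurableEmbedding Φ S
    rw [← key, hpre]
    simp_rw [hsymm]
    -- Fubini for the indicator of the slice set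
    set A : Set (ℝ × (Fin k → ℝ)) := {p | p.1 ∈ Icc (0 : ℝ) t ∧
        p.2 ∈ {w : Fin k → ℝ | (∀ i, w i ∈ Icc (0 : ℝ) p.1) ∧ Monotone w}} with hA
    have hAclosed : IsClosed A := by
      have h1 : IsClosed {p : ℝ × (Fin k → ℝ) | p.1 ∈ Icc (0 : ℝ) t} := isClosed_Icc.preimage continuous_fst
      have h2 : IsClosed {p : ℝ × (Fin k → ℝ) | ∀ i, p.2 i ∈ Icc (0 : ℝ) p.1} := by
        rw [setOf_forall]
        refine isClosed_iInter fun i => ?_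
        have hc : Continuous fun p : ℝ × (Fin k → ℝ) => p.2 i := (continuous_apply i).comp continuous_snd
        simp only [mem_Icc]
        exact (isClosed_le continuous_const hc).inter (isClosed_le hc continuous_fst)
      have h3 : IsClosed {p : ℝ × (Fin k → ℝ) | Monotone p.2} :=
        (isClosed_simplex k 0 |> fun _ => by
          have : {p : ℝ × (Fin k → ℝ) | Monotone p.2} = Prod.snd ⁻¹' {w : Fin k → ℝ | Monotone w} := rfl
          rw [this]
          have hm : IsClosed {w : Fin k → ℝ | Monotone w} := by
            have : {w : Fin k → ℝ | Monotone w} = ⋂ i : Fin k, ⋂ j : Fin k, {w | i ≤ j → w i ≤ w j} := by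
              ext w; simp only [mem_setOf_eq, mem_iInter, Monotone]
            rw [this]
            refine isClosed_iInter fun i => isClosed_iInter fun j => ?_
            by_cases hij : i ≤ j
            · simp only [hij, true_implies]
              exact isClosed_le (continuous_apply i) (continuous_apply j)
            · simp only [hij, false_implies, setOf_true]
              exact isClosed_univ
          exact hm.preimage continuous_snd)
      have hAeq : A = {p : ℝ × (Fin k → ℝ) | p.1 ∈ Icc (0 : ℝ) t} ∩
          ({p | ∀ i, p.2 i ∈ Icc (0 : ℝ) p.1} ∩ {p | Monotone p.2}) := by
        ext p; simp only [hA, mem_setOf_eq, mem_inter_iff]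
      rw [hAeq]
      exact h1.inter (h2.inter h3)
    have hAmeas : MeasurableSet A := hAclosed.measurableSet
    have hAbdd : A ⊆ Icc (0 : ℝ) t ×ˢ Set.pi univ (fun _ : Fin k => Icc (0 : ℝ) t) := by
      rintro ⟨u, w⟩ ⟨hu, hw, -⟩
      exact ⟨hu, mem_univ_pi.mpr fun i => ⟨(hw i).1, (hw i).2.trans hu.2⟩⟩
    have hAcpt : IsCompact A :=
      (isCompact_Icc.prod (isCompact_cube k t)).of_isClosed_subset hAclosed hAbdd
    have hF : Continuous fun p : ℝ × (Fin k → ℝ) => Φ (Fin.snoc p.2 p.1) :=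
      hΦ.comp ((continuous_finSnoc k).comp (continuous_snd.prodMk continuous_fst))
    have hInt : Integrable (A.indicator fun p : ℝ × (Fin k → ℝ) => Φ (Fin.snoc p.2 p.1))
        ((volume : Measure ℝ).prod (volume : Measure (Fin k → ℝ))) := by
      have := (hF.continuousOn.integrableOn_compact
        (μ := (volume : Measure (ℝ × (Fin k → ℝ)))) hAcpt).integrable_indicator hAmeas
      exact this
    rw [show (volume : Measure (ℝ × (Fin k → ℝ))) = (volume : Measure ℝ).prod volume from rfl,
      ← integral_indicator hAmeas, integral_prod _ hInt]
    -- the inner integrals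
    rw [← integral_indicator measurableSet_Icc]
    refine integral_congr_ae (Eventually.of_forall fun u => ?_)
    simp only
    by_cases hu : u ∈ Icc (0 : ℝ) t
    · rw [indicator_of_mem hu, ← integral_indicator (measurableSet_simplex k u)]
      refine integral_congr_ae (Eventually.of_forall fun w => ?_)
      simp only [indicator, hA, mem_setOf_eq, hu, true_and]
    · rw [indicator_of_notMem hu]
      have : ∀ w : Fin k → ℝ, A.indicator (fun p : ℝ × (Fin k → ℝ) => Φ (Fin.snoc p.2 p.1)) (u, w) = 0 :=
        fun w => indicator_of_notMem (fun h => hu h.1) _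
      simp only [this, integral_zero]

end SetIntegral

/-! ### Symmetrisation over the cube -/

section Symmetrization

variable (k : ℕ) (t : ℝ)

/-- The strict simplices `{w ∈ [0,t]^k : w ∘ σ strictly increasing}` are measurable. [folklore] -/
theorem measurableSet_strictSimplex (σ : Equiv.Perm (Fin k)) :
    MeasurableSet {w : Fin k → ℝ | (∀ i, w i ∈ Icc (0 : ℝ) t) ∧ StrictMono (fun i => w (σ i))} := by
  have h1 : IsClosed {w : Fin k → ℝ | ∀ i, w i ∈ Icc (0 : ℝ) t} := by
    rw [setOf_forall]
    exact isClosed_iInter fun i => isClosed_Icc.preimage (continuous_apply i)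
  have h2 : MeasurableSet {w : Fin k → ℝ | StrictMono (fun i => w (σ i))} := by
    have : {w : Fin k → ℝ | StrictMono (fun i => w (σ i))} =
        ⋂ i : Fin k, ⋂ j : Fin k, {w | i < j → w (σ i) < w (σ j)} := by
      ext w; simp only [mem_setOf_eq, mem_iInter, StrictMono]
    rw [this]
    refine MeasurableSet.iInter fun i => MeasurableSet.iInter fun j => ?_
    by_cases hij : i < j
    · simp only [hij, true_implies]
      exact (isOpen_lt (continuous_apply (σ i)) (continuous_apply (σ j))).measurableSet
    · simp only [hij, false_implies, setOf_true]
      exact MeasurableSet.univ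
  simpa only [setOf_and] using h1.measurableSet.inter h2

/-- Distinct permutations give disjoint strict simplices (the sorting permutation of a tuple with distinct
entries is unique). [folklore] -/
theorem disjoint_strictSimplex {σ τ : Equiv.Perm (Fin k)} (h : σ ≠ τ) :
    Disjoint {w : Fin k → ℝ | (∀ i, w i ∈ Icc (0 : ℝ) t) ∧ StrictMono (fun i => w (σ i))}
      {w : Fin k → ℝ | (∀ i, w i ∈ Icc (0 : ℝ) t) ∧ StrictMono (fun i => w (τ i))} := by
  rw [Set.disjoint_left]
  rintro w ⟨-, hσ⟩ ⟨-, hτ⟩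
  apply h
  have hστ : w ∘ σ = w ∘ τ := Tuple.unique_monotone hσ.monotone hτ.monotone
  have hinj : Function.Injective w := by
    intro a b hab
    have := hσ.injective (a₁ := σ.symm a) (a₂ := σ.symm b)
      (by simp only [Equiv.apply_symm_apply]; exact hab)
    simpa using this
  ext i
  have := congrFun hστ i
  simp only [Function.comp_apply] at this
  exact congrArg Fin.val (hinj this)

/-- The set where two coordinates coincide is Lebesgue-null. [folklore] -/
theorem volume_coincidence_eq_zero :
    volume (⋃ i : Fin k, ⋃ j : Fin k, {w : Fin k → ℝ | i ≠ j ∧ w i = w j}) = 0 := by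
  refine measure_iUnion_null fun i => measure_iUnion_null fun j => ?_
  by_cases hij : i = j
  · have : {w : Fin k → ℝ | i ≠ j ∧ w i = w j} = ∅ := by
      ext w; simp [hij]
    rw [this, measure_empty]
  · have : {w : Fin k → ℝ | i ≠ j ∧ w i = w j} = {w : Fin k → ℝ | w i = w j} := by
      ext w; simp [hij]
    rw [this]
    -- `{w | w i = w j}` is the kernel of the nonzero functional `w ↦ w i - w j`, a proper subspace
    -- (the same computation as the tree's Summits-side `volume_setOf_apply_eq_apply` of KontsevichZagierPeriods)
    set ℓ : (Fin k → ℝ) →ₗ[ℝ] ℝ :=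
      (LinearMap.proj i : (Fin k → ℝ) →ₗ[ℝ] ℝ) - (LinearMap.proj j : (Fin k → ℝ) →ₗ[ℝ] ℝ) with hℓ
    have hker : {w : Fin k → ℝ | w i = w j} = (LinearMap.ker ℓ : Set (Fin k → ℝ)) := by
      ext w
      simp only [mem_setOf_eq, SetLike.mem_coe, LinearMap.mem_ker, hℓ, LinearMap.sub_apply,
        LinearMap.proj_apply, sub_eq_zero]
    have hne : LinearMap.ker ℓ ≠ ⊤ := by
      intro htop
      have hmem : (Pi.single i (1 : ℝ) : Fin k → ℝ) ∈ LinearMap.ker ℓ := by rw [htop]; exact Submodule.mem_top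
      rw [LinearMap.mem_ker, hℓ, LinearMap.sub_apply, LinearMap.proj_apply, LinearMap.proj_apply,
        Pi.single_eq_same, Pi.single_eq_of_ne (Ne.symm hij), sub_zero] at hmem
      exact one_ne_zero hmem
    rw [hker]
    exact Measure.addHaar_submodule volume _ hne

/-- Off the coincidence set, every point of the cube lies in the strict simplex of its sorting
permutation. [folklore] -/
theorem cube_diff_iUnion_strictSimplex_subset :
    (Set.pi univ fun _ : Fin k => Icc (0 : ℝ) t) \
        (⋃ σ ∈ (Finset.univ : Finset (Equiv.Perm (Fin k))),
          {w : Fin k → ℝ | (∀ i, w i ∈ Icc (0 : ℝ) t) ∧ StrictMono (fun i => w (σ i))}) ⊆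
      ⋃ i : Fin k, ⋃ j : Fin k, {w : Fin k → ℝ | i ≠ j ∧ w i = w j} := by
  intro w hw
  rw [Set.mem_sdiff] at hw
  obtain ⟨hcube, hnot⟩ := hw
  by_contra hD
  apply hnot
  have hinj : Function.Injective w := by
    intro a b hab
    by_contra hne
    exact hD (mem_iUnion.mpr ⟨a, mem_iUnion.mpr ⟨b, hne, hab⟩⟩)
  refine mem_iUnion₂.mpr ⟨Tuple.sort w, Finset.mem_univ _, mem_univ_pi.mp hcube, ?_⟩
  exact (Tuple.monotone_sort w).strictMono_of_injective (hinj.comp (Tuple.sort w).injective)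

/-- The strict simplex of the identity differs from the ordered simplex by a null set. [folklore] -/
theorem strictSimplex_one_ae_eq_simplex :
    {w : Fin k → ℝ | (∀ i, w i ∈ Icc (0 : ℝ) t) ∧ StrictMono (fun i => w ((1 : Equiv.Perm (Fin k)) i))} =ᵐ[volume]
      {w : Fin k → ℝ | (∀ i, w i ∈ Icc (0 : ℝ) t) ∧ Monotone w} := by
  refine ae_eq_set.mpr ⟨?_, ?_⟩
  · have : {w : Fin k → ℝ | (∀ i, w i ∈ Icc (0 : ℝ) t) ∧ StrictMono (fun i => w ((1 : Equiv.Perm (Fin k)) i))} \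
        {w : Fin k → ℝ | (∀ i, w i ∈ Icc (0 : ℝ) t) ∧ Monotone w} = ∅ :=
      Set.sdiff_eq_empty.mpr fun w hw => ⟨hw.1, fun a b hab => hw.2.monotone hab⟩
    rw [this, measure_empty]
  · refine measure_mono_null ?_ (volume_coincidence_eq_zero k)
    intro w hw
    rw [Set.mem_sdiff] at hw
    obtain ⟨⟨hb, hm⟩, hns⟩ := hw
    have hns' : ¬ StrictMono w := fun hs => hns ⟨hb, fun a b hab => hs hab⟩
    simp only [StrictMono, not_forall, not_lt, exists_prop] at hns'
    obtain ⟨a, b, hab, hle⟩ := hns'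
    have heq : w a = w b := le_antisymm (hm hab.le) hle
    exact mem_iUnion.mpr ⟨a, mem_iUnion.mpr ⟨b, hab.ne, heq⟩⟩

omit [CompleteSpace E] in
/-- **Each strict simplex carries the same integral as the ordered simplex**, for a symmetric integrand
(coordinate permutations preserve Lebesgue measure). [folklore] -/
theorem setIntegral_strictSimplex_eq (Φ : (Fin k → ℝ) → E)
    (hsym : ∀ (σ : Equiv.Perm (Fin k)) (w : Fin k → ℝ), Φ (fun i => w (σ i)) = Φ w) (σ : Equiv.Perm (Fin k)) :
    ∫ w in {w : Fin k → ℝ | (∀ i, w i ∈ Icc (0 : ℝ) t) ∧ StrictMono (fun i => w (σ i))}, Φ w =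
      ∫ w in {w : Fin k → ℝ | (∀ i, w i ∈ Icc (0 : ℝ) t) ∧ Monotone w}, Φ w := by
  -- the coordinate permutation `T w = w ∘ σ`
  set T := MeasurableEquiv.piCongrLeft (fun _ : Fin k => ℝ) σ.symm with hT
  have hTapply : ∀ (w : Fin k → ℝ) (b : Fin k), T w b = w (σ b) := fun w b => by
    simp [hT, MeasurableEquiv.coe_piCongrLeft, Equiv.piCongrLeft_apply, eq_rec_constant]
  have hmp : MeasurePreserving T volume volume := volume_measurePreserving_piCongrLeft (fun _ : Fin k => ℝ) σ.symm
  set P1 : Set (Fin k → ℝ) := {w | (∀ i, w i ∈ Icc (0 : ℝ) t) ∧ StrictMono (fun i => w ((1 : Equiv.Perm (Fin k)) i))}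
    with hP1
  have hpre : T ⁻¹' P1 = {w : Fin k → ℝ | (∀ i, w i ∈ Icc (0 : ℝ) t) ∧ StrictMono (fun i => w (σ i))} := by
    ext w
    simp only [mem_preimage, hP1, mem_setOf_eq, hTapply, Equiv.Perm.coe_one, id_eq]
    refine and_congr_left fun _ => ⟨fun h i => ?_, fun h i => h (σ i)⟩
    simpa only [Equiv.apply_symm_apply] using h (σ.symm i)
  have key := hmp.setIntegral_preimage_emb T.measurableEmbedding Φ P1
  rw [hpre] at key
  have hΦT : ∀ w, Φ (T w) = Φ w := fun w => by
    have : (T w : Fin k → ℝ) = fun i => w (σ i) := funext (hTapply w)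
    rw [this, hsym σ w]
  simp_rw [hΦT] at key
  rw [key]
  exact setIntegral_congr_set (strictSimplex_one_ae_eq_simplex k t)

/-- **Symmetrisation: `I_k Φ t = (k!)⁻¹ ∫_{[0,t]^k} Φ`** for a continuous integrand symmetric under
permutations of its `k` variables and `t ≥ 0`. [cite: BratteliRobinsonI1987, Thm. 3.1.33] -/
theorem orderedIntegral_eq_inv_factorial_smul_setIntegral_cube (Φ : (Fin k → ℝ) → E) (hΦ : Continuous Φ)
    (hsym : ∀ (σ : Equiv.Perm (Fin k)) (w : Fin k → ℝ), Φ (fun i => w (σ i)) = Φ w) (ht : 0 ≤ t) :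
    orderedIntegral k Φ t = ((k ! : ℝ))⁻¹ • ∫ w in Set.pi univ (fun _ : Fin k => Icc (0 : ℝ) t), Φ w := by
  classical
  set cube : Set (Fin k → ℝ) := Set.pi univ (fun _ : Fin k => Icc (0 : ℝ) t) with hcube
  set P : Equiv.Perm (Fin k) → Set (Fin k → ℝ) := fun σ =>
    {w | (∀ i, w i ∈ Icc (0 : ℝ) t) ∧ StrictMono (fun i => w (σ i))} with hP
  set S : Set (Fin k → ℝ) := {w | (∀ i, w i ∈ Icc (0 : ℝ) t) ∧ Monotone w} with hS
  -- the cube is a.e. the disjoint union of the strict simplices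
  have hsub : (⋃ σ ∈ (Finset.univ : Finset (Equiv.Perm (Fin k))), P σ) ⊆ cube := by
    intro w hw
    obtain ⟨σ, -, hwσ⟩ := mem_iUnion₂.mp hw
    exact mem_univ_pi.mpr hwσ.1
  have hae : cube =ᵐ[volume] ⋃ σ ∈ (Finset.univ : Finset (Equiv.Perm (Fin k))), P σ := by
    refine ae_eq_set.mpr ⟨?_, ?_⟩
    · exact measure_mono_null (cube_diff_iUnion_strictSimplex_subset k t) (volume_coincidence_eq_zero k)
    · rw [Set.sdiff_eq_empty.mpr hsub, measure_empty]
  have hInt : IntegrableOn Φ cube volume := hΦ.continuousOn.integrableOn_compact (isCompact_cube k t)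
  have hsplit : ∫ w in cube, Φ w = ∑ σ ∈ (Finset.univ : Finset (Equiv.Perm (Fin k))), ∫ w in P σ, Φ w := by
    rw [setIntegral_congr_set hae]
    refine integral_biUnion_finset _ (fun σ _ => measurableSet_strictSimplex k t σ) ?_ (fun σ _ => ?_)
    · intro σ _ τ _ hστ
      exact disjoint_strictSimplex k t hστ
    · exact hInt.mono_set (fun w hw => mem_univ_pi.mpr hw.1)
  have hterm : ∀ σ : Equiv.Perm (Fin k), ∫ w in P σ, Φ w = ∫ w in S, Φ w := fun σ =>
    setIntegral_strictSimplex_eq k t Φ hsym σ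
  rw [Finset.sum_congr rfl (fun σ _ => hterm σ), Finset.sum_const, Finset.card_univ, Fintype.card_perm,
    Fintype.card_fin, ← Nat.cast_smul_eq_nsmul ℝ] at hsplit
  rw [hsplit, smul_smul, inv_mul_cancel₀ (by exact_mod_cast k.factorial_ne_zero), one_smul]
  exact orderedIntegral_eq_setIntegral_simplex k Φ hΦ t ht

end Symmetrization

end Literature.MathematicalPhysics.QuantumLattice
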